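import Literature.Topology.FourManifolds.DehnSurgeryLinkFundamentalGroup

/-!
# Sanity lemmas for the surgery gluing relations `surgeryRel` / `Link.surgeryRel` — pub-sp4mp REVIEW-RUNBOOK

Review evidence only (ops-runbook sanity registry `registry/pub-sp4mp.json`); no new definitions.
`surgeryRel ν a b` (`Literature/Topology/FourManifolds/DehnSurgery.lean`) relates the point `a` of the
knot complement `S³ ∖ K` to the point `b = (t • u, v)` of the open solid torus `D̊² × 𝕊 1` iff
`a = ν (u, t • v)` for some `u ∈ 𝕊 1`, `0 < t < 1` (`Knot.TubularNbhd.glueRel`); `Link.surgeryRel ν i`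
is the same relation for the tubular neighbourhood `ν i` of the `i`-th component.  For EVERY knot and
EVERY tubular neighbourhood `ν`:

* HOLDS: the base point `ν (1, e₀/2)` of the complement (`Knot.TubularNbhd.basePoint`, the base point of
  the meridian and longitude loops) is glued to the point `(e₀/2, 1)` of the new solid torus
  (`u = 1 = circlePoint 0`, `t = 1/2`) — also in the link form, for the one-component link `Link.ofKnot K`;
* FAILS: nothing is glued to a point `(0, v)` of the CORE CIRCLE of the new solid torus (a related point
  has `0 < ‖b.1‖`, `glueRel.norm_fst_mem_Ioo`) — the core circle is the genuinely new circle of the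
  surgered manifold;
* AGREEMENT: `Link.surgeryRel ν i a b ↔ surgeryRel (ν i) a b` with `a` regarded as a point of the `i`-th
  knot complement (the link complement lies in it) — definitional.
-/

namespace Summit.SmoothPoincare4.Runbook

open Set Literature.Topology.FourManifolds

/-! ## A point of the core circle of the open solid torus

(`(𝔼 2) × (𝕊 1)` of `Knots.lean` is written out: `EuclideanSpace ℝ (Fin 2) × Metric.sphere 0 1`; the base
point `(e₀/2, 1)` of the solid torus and its membership are the tree's `framingBaseVector_mem_solidTorus`,
`DehnSurgeryLinkFundamentalGroup.lean`.) -/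

/-- A point `(0, v)` of the core circle `{0} × 𝕊 1` lies in the open solid torus. -/
theorem core_mem_solidTorus (v : Metric.sphere (0 : EuclideanSpace ℝ (Fin 2)) 1) :
    (((0 : EuclideanSpace ℝ (Fin 2)), v) :
      EuclideanSpace ℝ (Fin 2) × Metric.sphere (0 : EuclideanSpace ℝ (Fin 2)) 1) ∈ solidTorus := by
  simp

/-! ## Knot surgery relation `surgeryRel ν` -/

section Knot

variable {K : Knot} (ν : Knot.TubularNbhd K)

/-- HOLDS: the base point `ν (1, e₀/2)` of the knot complement is glued to the point `(e₀/2, 1)` of the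
new solid torus — witnesses `u = circlePoint 0`, `t = 1/2`; both defining equations hold by `rfl`
(`framingBaseVector = (1/2) • ↑(circlePoint 0)`). -/
theorem surgeryRel_basePoint :
    surgeryRel ν ν.basePoint ⟨(framingBaseVector, circlePoint 0), framingBaseVector_mem_solidTorus⟩ :=
  ⟨circlePoint 0, 1 / 2, by norm_num, rfl, rfl⟩

/-- FAILS: no point of the knot complement is glued to a point of the core circle `{0} × 𝕊 1` of the new
solid torus (a glued point `b` has `0 < ‖b.1‖`). -/
theorem not_surgeryRel_core (a : K.complement) (v : Metric.sphere (0 : EuclideanSpace ℝ (Fin 2)) 1) :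
    ¬ surgeryRel ν a ⟨((0 : EuclideanSpace ℝ (Fin 2)), v), core_mem_solidTorus v⟩ := fun h ↦ by
  simpa using (Knot.TubularNbhd.glueRel.norm_fst_mem_Ioo h).1

end Knot

/-! ## Link surgery relation `Link.surgeryRel ν i` -/

section Link

variable {ι : Type*} [Finite ι] {L : Link ι} (ν : ∀ i, Knot.TubularNbhd (L.component i))

/-- AGREEMENT: the link surgery relation at the component `i` IS the knot surgery relation of the tubular
neighbourhood `ν i` of that component, the point of the link complement being regarded as a point of the
`i`-th knot complement (`Link.mem_complement_iff`: it lies off every component) — by `Iff.rfl`. -/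
theorem link_surgeryRel_iff (i : ι) (a : L.complement) (b : solidTorus) :
    Link.surgeryRel ν i a b ↔
      surgeryRel (ν i) ⟨(a : Metric.sphere (0 : EuclideanSpace ℝ (Fin 4)) 1),
        by simpa using (L.mem_complement_iff a).1 a.2 i⟩ b :=
  Iff.rfl

/-- FAILS (link form): nothing is glued to the core circle of the `i`-th new solid torus. -/
theorem link_not_surgeryRel_core (i : ι) (a : L.complement)
    (v : Metric.sphere (0 : EuclideanSpace ℝ (Fin 2)) 1) :
    ¬ Link.surgeryRel ν i a ⟨((0 : EuclideanSpace ℝ (Fin 2)), v), core_mem_solidTorus v⟩ := fun h ↦ by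
  simpa using (Knot.TubularNbhd.glueRel.norm_fst_mem_Ioo h).1

end Link

/-- HOLDS (link form): for the one-component link `Link.ofKnot K` with the tubular neighbourhood `ν` of its
only component, the base point `ν (1, e₀/2)` (a point of `(Link.ofKnot K).complement = K.complement`,
`Link.complement_ofKnot`) is glued to `(e₀/2, 1)` exactly as in `surgeryRel_basePoint`. -/
theorem link_surgeryRel_ofKnot_basePoint {K : Knot} (ν : Knot.TubularNbhd K) :
    Link.surgeryRel (L := Link.ofKnot K) (fun _ ↦ ν) (⟨0, Nat.one_pos⟩ : Fin 1)
      ⟨(ν.basePoint : Metric.sphere (0 : EuclideanSpace ℝ (Fin 4)) 1),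
        by rw [Link.complement_ofKnot]; exact ν.basePoint.2⟩
      ⟨(framingBaseVector, circlePoint 0), framingBaseVector_mem_solidTorus⟩ :=
  ⟨circlePoint 0, 1 / 2, by norm_num, rfl, rfl⟩

end Summit.SmoothPoincare4.Runbook
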